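import Summits.QuantumFields.YangMills.Theorems.LangevinControlUVFemtoCurvatureTwoPointCTorusUpper
import Summits.QuantumFields.YangMills.Theorems.LangevinControlUVFemtoCurvatureTwoPointCTorusTopLinkSharp
import Summits.QuantumFields.YangMills.Theorems.LangevinControlUVFemtoCurvatureTwoPointCBulkDoubling
import HarnessLib

/-!
# Route `LangevinControlUV`, crux `FemtoCurvatureTwoPointC` (stmt-QuantumFields-16204), line `birth` —
# the SHARP torus free-energy sandwich: upper bound with exponent `(D/2)(3L⁴ − 3)`, uniform
# doubling and the even-torus variance ceiling up to the holonomy corner `log β ≤ L⁴`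

Registered wave-7b sub-goals `torusPartitionFunction_upper_sharp`, `uniformDoubling_bulk4`,
`varianceCeilingEven_bulk4` (`--supports stmt-QuantumFields-16204`), proved verbatim. Setting: a
compact group `G` with a faithful continuous unitary lattice representation `r` (`D = dimE r.ρ`), the
torus `(ℤ/L)⁴`, the partition function `Z_L(β) = partitionFunction r.ρ β` and the Wilson expectation
`⟨·⟩_β = wilsonExpectation r.ρ β`.

**Sharp sandwich.** The landed sandwich reads
`e^{−A₀ L⁴} (C₁ β^{−D/2})^{3L⁴+1} ≤ Z_L(β) ≤ (C β^{−D/2})^{3L⁴ − L³ − L² − L}` (`β ≥ 1`, `L ≥ 2`;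
`torusPartitionFunction_lower`, p146937, and `torusPartitionFunction_upper`, p146095), so the doubling
`log Z_L(β/2) − log Z_L(β)` carried the slack `(D/2)(L³+L²+L+1) log β`, which is `O(L⁴)` only for
`log β ≤ L`. With the SHARP top-link assignment `torus_topLink_assignment_sharp` (p152623, a family of
`3L⁴ − 3` plaquettes each owning a private top link) the same triangular integration
(`lintegral_prod_le_pow_of_rank`, p143799, one-link Laplace bound `oneLinkLaplace_le_rpow`, p141871)
gives

* `torusPartitionFunction_upper_sharp` — `Z_L(β) ≤ (C β^{−D/2})^{3L⁴ − 3}` for `L ≥ 2`, `β ≥ 1`.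

The remaining `2D·log β` slack — exponents `(3L⁴ + 1) − (3L⁴ − 3) = 4`, times `D/2` — is exactly the
four wrap links, i.e. the holonomy (toron) sector of the torus; it is `O(L⁴)` as long as
`log β ≤ L⁴`. Hence the volume-UNIFORM bounds now hold for `2 ≤ β ≤ e^{L⁴}`:

* `uniformDoubling_bulk4` — ONE `A = A(r)` with `Z_L(β/2) ≤ e^{A L⁴} Z_L(β)` (`doubling_bookkeeping_sharp`:
  `A = 4D + 4|log C| + 4|log C₁| + |A₀|`);
* `varianceCeilingEven_bulk4` — on EVEN tori, `Var_β(P_0^{01}) = ⟨P_0 P_0⟩_β − ⟨P_0⟩_β² ≤ C' / β²`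
  with ONE `C' = 16 e^{A} / e²`, `P_x = N − Re tr r.ρ(U_{x;01})`: the chessboard estimate
  (`plaquetteChessboardEven_holds`, p114602) and AM–GM (`PlaquetteVariance.wilsonExpectation_prod_sq_le`)
  run pointwise with the doubling, verbatim as in `varianceCeilingEven_bulk` (p149639), the second
  countability of `G` being read off the faithful representation `r`.

Beyond `β > e^{L⁴}` (the deep holonomy corner) the slack is genuinely the toron sector and stays open.
Everything is proved from Mathlib and landed tree files; no named facts, no new definitions.
-/

set_option autoImplicit false

noncomputable section

open MeasureTheory
open scoped ENNReal
open Literature.MathematicalPhysics.QuantumFieldTheory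
open Summit.QuantumFields.YangMills.Theorems.FreeEnergyLogCoefficient (dimE)
open Summit.QuantumFields.YangMills.Theorems.FemtoCurvatureTwoPoint.PlaquetteVariance
open Summit.QuantumFields.YangMills.Cruxes.FemtoCurvatureTwoPoint.GenericStepGammaEncoding
  (PlaquetteChessboardEven plaquetteChessboardEven_holds)

namespace Summit.QuantumFields.YangMills.Theorems.FemtoCurvatureTwoPointC.TorusGauge

/-! ### The sharp triangular upper bound -/

/-- **Sharp triangular upper bound for the torus partition function** (registered wave-7b sub-goal of
line `birth`, crux `FemtoCurvatureTwoPointC`, stmt-QuantumFields-16204; the signature verbatim): for a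
compact second-countable group `G` with a faithful continuous unitary lattice representation `r`,
`D = dimE r.ρ`, there is `C > 0` (the one-link Laplace constant of `oneLinkLaplace_le_rpow`) with
`Z_L(β) ≤ (C β^{−D/2}) ^ (3L⁴ − 3)` for all `L ≥ 2`, `β ≥ 1`. Write `Z_L(β) = ∫ ∏ₚ wₚ` with
`wₚ = e^{−β(N − Re tr r(U_p))} ≤ 1`, keep only the `3L⁴ − 3` plaquettes of the SHARP top-link family
(`torus_topLink_assignment_sharp`), and integrate the links out from the highest rank down
(`lintegral_prod_le_pow_of_rank`): each member contributes one factor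
`∫ wₚ dU_{top p} = ∫ e^{−β(N − Re tr r(g))} dg ≤ C β^{−D/2}` by Haar invariance over one link
(`TorusUpper.lintegral_update_plaquetteHolonomy`). -/
theorem torusPartitionFunction_upper_sharp :
    ∀ {G : Type} [Group G] [TopologicalSpace G] [IsTopologicalGroup G] [CompactSpace G]
      [MeasurableSpace G] [BorelSpace G] [SecondCountableTopology G] (r : LatticeRep G),
      ∃ C : ℝ, 0 < C ∧ ∀ (L : ℕ) [NeZero L] (β : ℝ), 2 ≤ L → 1 ≤ β →
        (partitionFunction (d := 4) (L := L) r.ρ β).toReal ≤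
          (C * β ^ (-((dimE r.ρ : ℝ) / 2))) ^ (3 * L ^ 4 - 3) := by
  intro G _ _ _ _ _ _ _ r
  obtain ⟨C, hC, hlap⟩ :=
    FemtoCurvatureTwoPointC.oneLinkLaplace_le_rpow r.ρ r.continuous r.injective r.mem_unitary
  refine ⟨C, hC, fun L _ β hL hβ => ?_⟩
  obtain ⟨P, top, rk, hrk, htop, hcard, hP⟩ := torus_topLink_assignment_sharp L hL
  have hβ0 : 0 ≤ β := zero_le_one.trans hβ
  have hz0 : 0 ≤ C * β ^ (-((dimE r.ρ : ℝ) / 2)) :=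
    (mul_pos hC (Real.rpow_pos_of_pos (zero_lt_one.trans_le hβ) _)).le
  -- the four links of a plaquette and the plaquette weights
  let links : Plaquette 4 L → Finset (Edge 4 L) := fun p =>
    {(p.1, p.2.1.1), (p.1.shift p.2.1.1, p.2.1.2), (p.1.shift p.2.1.2, p.2.1.1), (p.1, p.2.1.2)}
  let w : Plaquette 4 L → GaugeConfig 4 L G → ℝ≥0∞ := fun p U => ENNReal.ofReal
    (Real.exp (-(β * ((r.N : ℝ) - (r.ρ (plaquetteHolonomy U p.1 p.2.1.1 p.2.1.2)).trace.re))))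
  have hw1 : ∀ (p : Plaquette 4 L) (U : GaugeConfig 4 L G), w p U ≤ 1 := fun p U =>
    TorusUpper.ofReal_boltzmann_le_one r.ρ r.continuous hβ0 _
  -- (1) drop the plaquettes outside the family `P`
  have hdrop : ∀ U : GaugeConfig 4 L G, ∏ p, w p U ≤ ∏ p ∈ P, w p U := fun U =>
    Finset.prod_le_prod_of_subset_of_le_one' (Finset.subset_univ P) fun p _ _ => hw1 p U
  -- (2) triangular integration over the family `P`, one link bound `z = C β^{-D/2}`
  have hmain : ∫⁻ U, ∏ p ∈ P, w p U ∂(Measure.pi fun _ : Edge 4 L => haarProbability G) ≤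
      ENNReal.ofReal (C * β ^ (-((dimE r.ρ : ℝ) / 2))) ^ P.card := by
    refine lintegral_prod_le_pow_of_rank (haarProbability G) P links top rk hrk htop
      (fun p hp => (hP p hp).1) (fun p hp => (hP p hp).2) w
      (fun p _ => TorusUpper.measurable_weight r.ρ r.continuous β p) (fun p _ U => hw1 p U)
      (fun p _ U V hUV => ?_) _ (fun p hp U => ?_)
    · -- the weight of `p` depends only on the four links of `p`
      show ENNReal.ofReal _ = ENNReal.ofReal _
      rw [TorusUpper.plaquetteHolonomy_eq_of_eqOn p fun e he => hUV e (Finset.mem_coe.2 he)]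
    · -- integrating out the top link of `p` gives the one-link Laplace integral
      show ∫⁻ g, ENNReal.ofReal (Real.exp (-(β * ((r.N : ℝ) -
          (r.ρ (plaquetteHolonomy (Function.update U (top p) g) p.1 p.2.1.1 p.2.1.2)).trace.re))))
          ∂haarProbability G ≤ _
      rw [TorusUpper.lintegral_update_plaquetteHolonomy
          (TorusUpper.measurable_ofReal_boltzmann r.ρ r.continuous β) hL U p (hP p hp).1,
        TorusUpper.lintegral_ofReal_boltzmann r.ρ r.continuous β]
      exact ENNReal.ofReal_le_ofReal (hlap β hβ)
  -- (3) assemble: `Z ≤ z ^ #P`, `#P = 3L⁴ − 3`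
  have hcardP : P.card = 3 * L ^ 4 - 3 := by omega
  have hZ : partitionFunction (d := 4) (L := L) r.ρ β ≤
      ENNReal.ofReal (C * β ^ (-((dimE r.ρ : ℝ) / 2))) ^ P.card := by
    rw [TorusUpper.partitionFunction_eq_lintegral_prod r.ρ β]
    exact (lintegral_mono fun U => hdrop U).trans hmain
  calc (partitionFunction (d := 4) (L := L) r.ρ β).toReal
      ≤ (ENNReal.ofReal (C * β ^ (-((dimE r.ρ : ℝ) / 2))) ^ P.card).toReal :=
        ENNReal.toReal_mono (ENNReal.pow_ne_top ENNReal.ofReal_ne_top) hZ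
    _ = (C * β ^ (-((dimE r.ρ : ℝ) / 2))) ^ (3 * L ^ 4 - 3) := by
        rw [ENNReal.toReal_pow, ENNReal.toReal_ofReal hz0, hcardP]

/-! ### The sharp bookkeeping inequality -/

/-- **Bookkeeping of the sharp sandwich exponents.** With `M = 3L⁴ − 3` plaquettes in the sharp
upper bound, `3L⁴ + 1` off-comb links in the lower bound, `ℓ = log β ≤ L⁴`, `l₂ = log 2 ≤ 1`,
`D ≥ 0` and `L ≥ 2`:
`M (log C − (D/2)(ℓ − l₂)) − (−A₀ L⁴ + (3L⁴+1)(log C₁ − (D/2) ℓ)) ≤ (4D + 4|log C| + 4|log C₁| + |A₀|) L⁴`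
(the `log β` terms leave exactly `((3L⁴+1) − (3L⁴−3)) (D/2) ℓ = 2D ℓ ≤ 2D L⁴`: the four wrap links). -/
theorem doubling_bookkeeping_sharp {L D A₀ lC lC₁ l₂ ℓ : ℝ} (hL : 2 ≤ L) (hD : 0 ≤ D)
    (hℓ : ℓ ≤ L ^ 4) (hl1 : l₂ ≤ 1) :
    (3 * L ^ 4 - 3) * (lC + -(D / 2) * (ℓ - l₂)) -
        (-(A₀ * L ^ 4) + (3 * L ^ 4 + 1) * (lC₁ + -(D / 2) * ℓ)) ≤
      (4 * D + 4 * |lC| + 4 * |lC₁| + |A₀|) * L ^ 4 := by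
  have hL4 : 1 ≤ L ^ 4 := one_le_pow₀ (by linarith : (1 : ℝ) ≤ L)
  -- the cardinalities `M = 3L⁴ − 3` and `3L⁴ + 1` lie in `[0, 4L⁴]` and differ by `4`
  have hM0 : 0 ≤ 3 * L ^ 4 - 3 := by linarith
  have hM4 : 3 * L ^ 4 - 3 ≤ 4 * L ^ 4 := by linarith
  have hN4 : 3 * L ^ 4 + 1 ≤ 4 * L ^ 4 := by linarith
  -- termwise bounds
  have ha : (3 * L ^ 4 - 3) * lC ≤ 4 * L ^ 4 * |lC| := by
    nlinarith [mul_nonneg hM0 (sub_nonneg.2 (le_abs_self lC)),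
      mul_nonneg (sub_nonneg.2 hM4) (abs_nonneg lC)]
  have hb : (3 * L ^ 4 - 3) * (D / 2 * l₂) ≤ 4 * L ^ 4 * (D / 2) := by
    nlinarith [mul_nonneg hM0 (mul_nonneg (by linarith : 0 ≤ D / 2) (sub_nonneg.2 hl1)),
      mul_nonneg (sub_nonneg.2 hM4) (by linarith : 0 ≤ D / 2)]
  have hc : 4 * (D / 2 * ℓ) ≤ 2 * D * L ^ 4 := by
    nlinarith [mul_nonneg hD (sub_nonneg.2 hℓ)]
  have hd : A₀ * L ^ 4 ≤ |A₀| * L ^ 4 := mul_le_mul_of_nonneg_right (le_abs_self _) (by positivity)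
  have he : -((3 * L ^ 4 + 1) * lC₁) ≤ 4 * L ^ 4 * |lC₁| := by
    nlinarith [mul_nonneg (by positivity : 0 ≤ 3 * L ^ 4 + 1) (sub_nonneg.2 (neg_le_abs lC₁)),
      mul_nonneg (sub_nonneg.2 hN4) (abs_nonneg lC₁)]
  nlinarith [ha, hb, hc, hd, he]

/-! ### The registered doubling and variance statements -/

/-- **Uniform torus free-energy doubling up to the holonomy corner** (registered wave-7b sub-goal of
line `birth`, crux `FemtoCurvatureTwoPointC`, stmt-QuantumFields-16204; the signature verbatim): for a
compact second-countable group `G` with a faithful continuous unitary lattice representation `r` there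
is ONE `A` with `Z_L(β/2) ≤ e^{A L⁴} Z_L(β)` for every torus `(ℤ/L)⁴`, `L ≥ 2`, and every
`2 ≤ β ≤ e^{L⁴}` — the logarithm of the SHARP torus sandwich (`torusPartitionFunction_upper_sharp` at
`β/2`, `torusPartitionFunction_lower` at `β`) and the bookkeeping `doubling_bookkeeping_sharp`. -/
theorem uniformDoubling_bulk4 :
    ∀ {G : Type} [Group G] [TopologicalSpace G] [IsTopologicalGroup G] [CompactSpace G]
      [MeasurableSpace G] [BorelSpace G] [SecondCountableTopology G] (r : LatticeRep G),
      ∃ A : ℝ, ∀ (L : ℕ) [NeZero L] (β : ℝ), 2 ≤ L → 2 ≤ β → Real.log β ≤ (L : ℝ) ^ 4 →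
        (partitionFunction (d := 4) (L := L) r.ρ (β / 2)).toReal ≤
          Real.exp (A * (L : ℝ) ^ 4) * (partitionFunction (d := 4) (L := L) r.ρ β).toReal := by
  intro G _ _ _ _ _ _ _ r
  obtain ⟨C₁, A₀, hC₁, hlow⟩ := torusPartitionFunction_lower r
  obtain ⟨C, hC, hup⟩ := torusPartitionFunction_upper_sharp r
  refine ⟨4 * (dimE r.ρ : ℝ) + 4 * |Real.log C| + 4 * |Real.log C₁| + |A₀|,
    fun L _ β hL hβ hlogβ => ?_⟩
  have hβ0 : 0 < β := by linarith
  have hβ1 : 1 ≤ β := by linarith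
  have hβh : 1 ≤ β / 2 := by linarith
  have hβh0 : 0 < β / 2 := by linarith
  have hL2 : (2 : ℝ) ≤ L := by exact_mod_cast hL
  have hZh := partitionFunction_toReal_pos (d := 4) (L := L) r.ρ r.continuous (β / 2)
  have hZb := partitionFunction_toReal_pos (d := 4) (L := L) r.ρ r.continuous β
  -- the two power laws `x = (β/2)^{-D/2}`, `y = β^{-D/2}` and their logarithms
  have hx : 0 < (β / 2) ^ (-((dimE r.ρ : ℝ) / 2)) := Real.rpow_pos_of_pos hβh0 _
  have hy : 0 < β ^ (-((dimE r.ρ : ℝ) / 2)) := Real.rpow_pos_of_pos hβ0 _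
  have hlogx : Real.log ((β / 2) ^ (-((dimE r.ρ : ℝ) / 2))) =
      -((dimE r.ρ : ℝ) / 2) * (Real.log β - Real.log 2) := by
    rw [Real.log_rpow hβh0, Real.log_div hβ0.ne' two_ne_zero]
  have hlogy : Real.log (β ^ (-((dimE r.ρ : ℝ) / 2))) = -((dimE r.ρ : ℝ) / 2) * Real.log β :=
    Real.log_rpow hβ0 _
  -- the cardinality of the sharp top-link plaquette family, as a real number
  have hMle : 3 ≤ 3 * L ^ 4 := by
    have h4 : 0 < L ^ 4 := pow_pos (by omega) 4
    omega
  have hM : ((3 * L ^ 4 - 3 : ℕ) : ℝ) = 3 * (L : ℝ) ^ 4 - 3 := by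
    rw [Nat.cast_sub hMle]
    push_cast
    ring
  -- UPPER half of the sharp sandwich at `β/2 ≥ 1`, in logarithmic form
  have hU : Real.log (partitionFunction (d := 4) (L := L) r.ρ (β / 2)).toReal ≤
      (3 * (L : ℝ) ^ 4 - 3) *
        (Real.log C + -((dimE r.ρ : ℝ) / 2) * (Real.log β - Real.log 2)) := by
    have h := Real.log_le_log hZh (hup L (β / 2) hL hβh)
    rwa [Real.log_pow, Real.log_mul hC.ne' hx.ne', hlogx, hM] at h
  -- LOWER half of the sandwich at `β ≥ 1`, in logarithmic form
  have hLo : -(A₀ * (L : ℝ) ^ 4) + (3 * (L : ℝ) ^ 4 + 1) *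
        (Real.log C₁ + -((dimE r.ρ : ℝ) / 2) * Real.log β) ≤
      Real.log (partitionFunction (d := 4) (L := L) r.ρ β).toReal := by
    have hpos : 0 < Real.exp (-(A₀ * (L : ℝ) ^ 4)) *
        (C₁ * β ^ (-((dimE r.ρ : ℝ) / 2))) ^ (3 * L ^ 4 + 1) :=
      mul_pos (Real.exp_pos _) (pow_pos (mul_pos hC₁ hy) _)
    have h := Real.log_le_log hpos (hlow L β hβ1)
    rw [Real.log_mul (Real.exp_pos _).ne' (pow_pos (mul_pos hC₁ hy) _).ne', Real.log_exp,
      Real.log_pow, Real.log_mul hC₁.ne' hy.ne', hlogy] at h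
    push_cast at h
    exact h
  -- bookkeeping: the difference of the two logarithms is `≤ A L⁴` as long as `log β ≤ L⁴`
  have hbook := doubling_bookkeeping_sharp (A₀ := A₀) (lC := Real.log C) (lC₁ := Real.log C₁) hL2
    (Nat.cast_nonneg (dimE r.ρ)) hlogβ ((Real.log_le_sub_one_of_pos two_pos).trans (by norm_num))
  -- exponentiate
  rw [← Real.log_le_log_iff hZh (mul_pos (Real.exp_pos _) hZb),
    Real.log_mul (Real.exp_pos _).ne' hZb.ne', Real.log_exp]
  linarith

/-- **The variance ceiling on even tori up to the holonomy corner, volume-uniform** (registered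
wave-7b sub-goal of line `birth`, crux `FemtoCurvatureTwoPointC`, stmt-QuantumFields-16204; the
signature verbatim): ONE `C = 16 e^{A} / e²` with `⟨P_0 P_0⟩_β − ⟨P_0⟩_β² ≤ C · (β²)⁻¹` for every EVEN
torus `(ℤ/L)⁴`, `L ≥ 2`, and `2 ≤ β ≤ e^{L⁴}`, `P_0 = N − Re tr r.ρ(U_{0;01})` — the argument of
`varianceCeilingEven_bulk` (chessboard estimate p114602 + AM–GM) run pointwise with the doubling
`uniformDoubling_bulk4`, the second countability of `G` being read off the faithful representation `r`. -/
theorem varianceCeilingEven_bulk4 :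
    ∀ {G : Type} [Group G] [TopologicalSpace G] [IsTopologicalGroup G] [CompactSpace G]
      [MeasurableSpace G] [BorelSpace G] (r : LatticeRep G),
      ∃ C : ℝ, ∀ (L : ℕ) [NeZero L], Even L → 2 ≤ L → ∀ β : ℝ, 2 ≤ β → Real.log β ≤ (L : ℝ) ^ 4 →
        ∀ (P : (Fin 4 → ZMod L) → Fin 4 → Fin 4 → GaugeConfig 4 L G → ℝ)
          (E : (GaugeConfig 4 L G → ℝ) → ℝ),
          (P = fun x i j U => (r.N : ℝ) - (r.ρ (plaquetteHolonomy U x i j)).trace.re) →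
          (E = fun F => wilsonExpectation r.ρ β F) →
          E (fun U => P 0 0 1 U * P 0 0 1 U) - E (P 0 0 1) * E (P 0 0 1) ≤ C * (β ^ 2)⁻¹ := by
  intro G i1 i2 i3 i4 i5 i6 r
  -- `G` is second countable: it embeds into `M_N(ℂ)` through the faithful `r`
  haveI : SecondCountableTopology (Matrix (Fin r.N) (Fin r.N) ℂ) :=
    inferInstanceAs (SecondCountableTopology (Fin r.N → Fin r.N → ℂ))
  haveI : SecondCountableTopology G :=
    (r.continuous.isClosedEmbedding r.injective).isEmbedding.secondCountableTopology
  obtain ⟨A, hA⟩ := uniformDoubling_bulk4 r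
  refine ⟨16 * Real.exp A / Real.exp 1 ^ 2, ?_⟩
  intro L iL hL h2 β hβ hlogβ P E hP hE
  subst hP hE
  dsimp only
  have hβ1 : 1 ≤ β := by linarith
  have hβ0 : 0 < β := by linarith
  -- the doubling at `(L, β)`
  have hdbl : (partitionFunction (d := 4) (L := L) r.ρ (β / 2)).toReal ≤
      Real.exp (A * (L : ℝ) ^ 4) * (partitionFunction (d := 4) (L := L) r.ρ β).toReal :=
    hA L β h2 hβ hlogβ
  -- (i) `|Var P| ≤ ⟨P²⟩`
  have hXm := measurable_plaq01 r.ρ r.continuous (0 : Site 4 L)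
  have hXb : ∀ U : GaugeConfig 4 L G,
      |(r.N : ℝ) - (r.ρ (plaquetteHolonomy U 0 0 1)).trace.re| ≤ 2 * r.N := fun U => by
    obtain ⟨h0, h2'⟩ := plaqField_mem r.ρ r.continuous (plaquetteHolonomy U 0 0 1)
    rw [abs_of_nonneg h0]
    exact h2'
  have hvar := abs_var_le_wilsonExpectation_sq r.ρ r.continuous β hXm hXb
  -- (ii) chessboard (landed, all even tori) with `f = min (t², 4N²)`, `f(P_x) = P_x²`
  have hCh : PlaquetteChessboardEven := plaquetteChessboardEven_holds
  unfold PlaquetteChessboardEven at hCh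
  have hmin : ∀ (U : GaugeConfig 4 L G) (x : Site 4 L),
      min (((r.N : ℝ) - (r.ρ (plaquetteHolonomy U x 0 1)).trace.re) ^ 2) ((2 * (r.N : ℝ)) ^ 2) =
        ((r.N : ℝ) - (r.ρ (plaquetteHolonomy U x 0 1)).trace.re) ^ 2 := fun U x => by
    obtain ⟨h0, h2'⟩ := plaqField_mem r.ρ r.continuous (plaquetteHolonomy U x 0 1)
    exact min_eq_left (pow_le_pow_left₀ h0 h2' 2)
  have hf := hCh G r.N r.ρ r.continuous r.mem_unitary L hL β hβ0.le
    (fun t => min (t ^ 2) ((2 * (r.N : ℝ)) ^ 2))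
    ((continuous_id.pow 2).min continuous_const).measurable
    (fun t => le_min (sq_nonneg t) (sq_nonneg _)) ⟨(2 * (r.N : ℝ)) ^ 2, fun t => min_le_right _ _⟩
  simp only [hmin] at hf
  -- (iii)–(v) `⟨∏ₓ P_x²⟩ ≤ M^{L⁴}` with `M = (4/(eβ))² e^{A}`
  have hprod : wilsonExpectation r.ρ β (fun U : GaugeConfig 4 L G =>
      ∏ x : Site 4 L, ((r.N : ℝ) - (r.ρ (plaquetteHolonomy U x 0 1)).trace.re) ^ 2) ≤
        ((4 / (Real.exp 1 * β)) ^ 2 * Real.exp A) ^ (L ^ 4) := by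
    refine (wilsonExpectation_prod_sq_le r.ρ r.continuous hβ0).trans ?_
    have hZ := partitionFunction_toReal_pos (d := 4) (L := L) r.ρ r.continuous β
    have hratio : (partitionFunction (d := 4) (L := L) r.ρ (β / 2)).toReal /
        (partitionFunction (d := 4) (L := L) r.ρ β).toReal ≤ Real.exp (A * (L : ℝ) ^ 4) := by
      rw [div_le_iff₀ hZ]
      exact hdbl
    calc (4 / (Real.exp 1 * β)) ^ (2 * L ^ 4) *
          ((partitionFunction (d := 4) (L := L) r.ρ (β / 2)).toReal /
            (partitionFunction (d := 4) (L := L) r.ρ β).toReal)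
        ≤ (4 / (Real.exp 1 * β)) ^ (2 * L ^ 4) * Real.exp (A * (L : ℝ) ^ 4) :=
          mul_le_mul_of_nonneg_left hratio (pow_nonneg (by positivity) _)
      _ = ((4 / (Real.exp 1 * β)) ^ 2 * Real.exp A) ^ (L ^ 4) := by
          rw [pow_mul, mul_pow, ← Real.exp_nat_mul]
          congr 2
          push_cast
          ring
  -- (vi) the `L⁴`-th root
  have hroot : (wilsonExpectation r.ρ β (fun U : GaugeConfig 4 L G =>
      ∏ x : Site 4 L, ((r.N : ℝ) - (r.ρ (plaquetteHolonomy U x 0 1)).trace.re) ^ 2)) ^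
        ((1 : ℝ) / (L : ℝ) ^ 4) ≤ (4 / (Real.exp 1 * β)) ^ 2 * Real.exp A := by
    have h0 : 0 ≤ wilsonExpectation r.ρ β (fun U : GaugeConfig 4 L G =>
        ∏ x : Site 4 L, ((r.N : ℝ) - (r.ρ (plaquetteHolonomy U x 0 1)).trace.re) ^ 2) :=
      wilsonExpectation_nonneg r.ρ β fun U => Finset.prod_nonneg fun x _ => sq_nonneg _
    have hM0 : 0 ≤ (4 / (Real.exp 1 * β)) ^ 2 * Real.exp A := by positivity
    have hk0 : L ^ 4 ≠ 0 := pow_ne_zero 4 (NeZero.ne L)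
    calc _ ≤ (((4 / (Real.exp 1 * β)) ^ 2 * Real.exp A) ^ (L ^ 4)) ^ ((1 : ℝ) / (L : ℝ) ^ 4) :=
          Real.rpow_le_rpow h0 hprod (by positivity)
      _ = (4 / (Real.exp 1 * β)) ^ 2 * Real.exp A := by
          rw [one_div, ← Nat.cast_pow]
          exact Real.pow_rpow_inv_natCast hM0 hk0
  -- assembly: `Var ≤ |Var| ≤ ⟨P²⟩ ≤ ⟨∏ₓ P_x²⟩^{1/L⁴} ≤ (4/(eβ))² e^{A} = C · (β²)⁻¹`
  have hβne : β ≠ 0 := hβ0.ne'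
  calc _ ≤ (4 / (Real.exp 1 * β)) ^ 2 * Real.exp A :=
        (le_abs_self _).trans (hvar.trans (hf.trans hroot))
    _ = 16 * Real.exp A / Real.exp 1 ^ 2 * (β ^ 2)⁻¹ := by
        field_simp
        ring

end Summit.QuantumFields.YangMills.Theorems.FemtoCurvatureTwoPointC.TorusGauge

end
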